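import Literature.AlgebraicGeometry.Motives.JacobianGaloisCoverNormImage
import Literature.AlgebraicGeometry.Motives.AbelianVarietyDihedralIdempotentRelations
import HarnessLib

/-!
# Dihedral and Klein-four group actions on a curve: the Kani–Rosen relations WITH the quotient Jacobians —
# `J_X × J_{X/D_n}² ∼ J_{X/⟨σ⟩} × J_{X/⟨τ⟩}²` (`n` odd), `J_X × J_{X/D_n}² ∼ J_{X/⟨σ⟩} × J_{X/⟨τ⟩} × J_{X/⟨στ⟩}` (`n` even),
# `J_X × J_{X/V₄}² ∼ J_{X/⟨a⟩} × J_{X/⟨b⟩} × J_{X/⟨ab⟩}`, and the genus relations (Paulhus 2008 §3; Kani–Rosen 1989 Thm. B; Accola)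

Layer `Literature/AlgebraicGeometry/Motives`, namespace `Literature.AlgebraicGeometry.Motives.Jacobian`.  THEOREMS ONLY: the dihedral
isogeny relations of `Motives/AbelianVarietyDihedralIdempotentRelations` (stated there for an abelian variety `X` with a `G`-action and
the IMAGES `B_H = Im N_H = ε_H(X)`, «the quotient-curve reading `ε_H(J_X) ∼ J_{X/H}` is not asserted here») are transported to the
Jacobians of the quotient curves along ★ `Motives/JacobianGaloisCoverNormImage` (`Jacobian.isIsogenous_image_sum_pushforward_act`:
`Im(Σ_{h ∈ H} h_*) ∼ J_{X/H}` for a quotient `X → X/H` with pinned pull-back, any field; ★ `dim_image_sum_pushforward_act_eq`), in the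
def-free currency of ★ `Motives/JacobianGaloisCoverNorm` (`t` pinned by `Nm_q ≫ t = Σ_{h ∈ H} h_*`).  No definition, no named fact, no
instance, no `sorry`; nothing of the prequels is restated.

THE PRINT.  J. Paulhus, *Decomposing Jacobians of curves with extra automorphisms*, Acta Arith. 132 (2008) (`paper:doi-10-4064-aa132-3-3`),
§3 p. 234: «(3) `J_X × J²_{X/⟨a,b⟩} ∼ J_{X/⟨a⟩} × J_{X/⟨b⟩} × J_{X/⟨ab⟩}`» (Klein four-group `V₄ = ⟨a⟩ ∪ ⟨b⟩ ∪ ⟨ab⟩`, halved);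
§3.1.2 p. 236: «`m` odd. In this case, all involutions in `D_{2m}` are in the same conjugacy class. Applying Theorem 2 gives us
(5) `J_X × J²_{X/D_{2m}} ∼ J_{X/⟨r⟩} × J²_{X/⟨s⟩}`».  E. Kani, M. Rosen, Math. Ann. 284 (1989), Thm. B.  H. Lange, R. E. Rodríguez,
*Decomposition of Jacobians by Prym Varieties* (2022), §6.2.2 Lemma 6.2.4 (the dihedral genus relation).

WHAT IS PROVED (perfect ground field for the isogenies; `G` a finite group with `act : G →* Aut X`, quotients `q_H : X → X/H` with
`IsSepQuotient` for `H = G, ⟨σ⟩, ⟨τ⟩, ⟨στ⟩`, their Jacobians and pinned pull-backs, a rational point `P₀` of `X`):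
* **`isIsogenous_dihedral_odd_quotientJacobian`** — `G ≅ D_n` (`|G| = 2|σ|`, `|τ| = 2`, `τστ⁻¹ = σ⁻¹`), `n = |σ|` odd:
  `J_X × J_{X/G}² ∼ J_{X/⟨σ⟩} × J_{X/⟨τ⟩}²` (★ `AbelianVariety.isIsogenous_dihedral_odd`); genus form **`dim_dihedral_odd_quotientJacobian`**:
  `g_X + 2 g_{X/G} = g_{X/⟨σ⟩} + 2 g_{X/⟨τ⟩}` read on `dim J`.
* **`isIsogenous_dihedral_even_quotientJacobian`** — `n` even, `τ ∉ ⟨σ⟩`: `J_X × J_{X/G}² ∼ J_{X/⟨σ⟩} × J_{X/⟨τ⟩} × J_{X/⟨στ⟩}`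
  (★ `isIsogenous_dihedral_even`); **`dim_dihedral_even_quotientJacobian`**.
* **`isIsogenous_kleinFour_quotientJacobian`** — `G ≅ V₄ = {1, a, b, ab}` (`IsKleinFour G`), the case `n = 2`:
  `J_X × J_{X/G}² ∼ J_{X/⟨a⟩} × J_{X/⟨b⟩} × J_{X/⟨ab⟩}` and Accola's **`dim_kleinFour_quotientJacobian`**:
  `g_X + 2 g_{X/G} = g_{X/⟨a⟩} + g_{X/⟨b⟩} + g_{X/⟨ab⟩}`.

Scope (stated, not hidden). (1) As in the prequels the pull-backs are binders `t_H` with their pins; Jacobians and quotient curves are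
hypotheses.  (2) The isogenies need a perfect field (Hom-count criterion behind the prequel); the genus forms are their `dim` shadows
(★ `IsIsogenous.dim_eq`, ★ `dim_biprod`); genus `= dim J` is not restated (`Motives/JacobianDimensionEqCurveGenus`, over `ℂ`).  (3) The
TORUS-carrier files `Geometry/Kaehler/RiemannSurface{KaniRosenGenusRelations,AccolaGenusRelation}` treat compact Riemann surfaces via period
matrices — different carrier and objects (RULING 29 bis), nothing imported or restated.  Cell `hodgecm-mathlib` (D-0151), PROOF lane,
count-neutral (`--supports stmt-HodgeConjecture-24832`); HC_CM is proved only modulo the 7 printed citations until rung 0 closes.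

## References
* [Paulhus2008] J. Paulhus, Acta Arith. 132 (2008) 231–244: §3 (2)–(3) (p. 234), §3.1.2 (5) (p. 236).
* [KaniRosen1989] E. Kani, M. Rosen, *Idempotent relations and factors of Jacobians*, Math. Ann. 284 (1989) 307–327, Thm. B.
* [LangeRodriguez2022] H. Lange, R. E. Rodríguez, *Decomposition of Jacobians by Prym Varieties*, LNM 2310 (2022): §3.5.1 Prop. 3.5.1,
  Cor. 3.5.2 (p. 65); §6.2.2 Lemma 6.2.4.
* [HonigsSarmah2025] the dihedral Hom counts as cited in `Motives/AbelianVarietyDihedralIdempotentRelations` (§4 Thm. 4.2).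
-/

set_option autoImplicit false

noncomputable section

universe u

open CategoryTheory CategoryTheory.Limits AlgebraicGeometry

namespace Literature.AlgebraicGeometry.Motives

namespace Jacobian

variable {k : Type u} [Field k] [PerfectField k] {X : SchemeOver k} (𝒥X : Jacobian X)
  {G : Type} [Group G] [Fintype G] (act : G →* Aut X) {σ τ : G}

/-! ## §1 Dihedral groups `D_n = ⟨σ⟩ ⋊ ⟨τ⟩` -/

/-- **`J_X × J_{X/D_n}² ∼ J_{X/⟨σ⟩} × J_{X/⟨τ⟩}²` for `n = |σ|` odd** («`m` odd […] `J_X × J²_{X/D_{2m}} ∼ J_{X/⟨r⟩} × J²_{X/⟨s⟩}`»):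
a finite group `G` with `|G| = 2|σ|`, `|τ| = 2`, `τστ⁻¹ = σ⁻¹` acting on `X` (`act : G →* Aut X`), quotients `q_G : X → X/G`,
`q_σ : X → X/⟨σ⟩`, `q_τ : X → X/⟨τ⟩` (`IsSepQuotient`) with Jacobians and pinned pull-backs, a rational point on `X`, perfect ground field —
★ `AbelianVariety.isIsogenous_dihedral_odd` (images `Im N_H`) transported along ★ `Jacobian.isIsogenous_image_sum_pushforward_act`.
[cite: Paulhus2008, §3.1.2 (5) (p. 236)] [cite: KaniRosen1989, Thm. B] [cite: LangeRodriguez2022, §3.5.1 Prop. 3.5.1 and Cor. 3.5.2 (a) (p. 65)] -/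
theorem isIsogenous_dihedral_odd_quotientJacobian [Fintype (Subgroup.zpowers σ)] [Fintype (Subgroup.zpowers τ)]
    (hG : Fintype.card G = 2 * orderOf σ) (hodd : Odd (orderOf σ)) (hτ : orderOf τ = 2) (hστ : τ * σ * τ⁻¹ = σ⁻¹)
    {YG Yσ Yτ : SchemeOver k} (𝒥G : Jacobian YG) (𝒥σ : Jacobian Yσ) (𝒥τ : Jacobian Yτ)
    (qG : X ⟶ YG) (hqG : IsSepQuotient (fun g : G => act g) qG) (tG : 𝒥G.J ⟶ 𝒥X.J)
    (htG : 𝒥X.pushforward 𝒥G qG ≫ tG = ∑ g : G, 𝒥X.pushforward 𝒥X (act g).hom)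
    (qσ : X ⟶ Yσ) (hqσ : IsSepQuotient (fun h : Subgroup.zpowers σ => act h) qσ) (tσ : 𝒥σ.J ⟶ 𝒥X.J)
    (htσ : 𝒥X.pushforward 𝒥σ qσ ≫ tσ = ∑ h : Subgroup.zpowers σ, 𝒥X.pushforward 𝒥X (act h).hom)
    (qτ : X ⟶ Yτ) (hqτ : IsSepQuotient (fun h : Subgroup.zpowers τ => act h) qτ) (tτ : 𝒥τ.J ⟶ 𝒥X.J)
    (htτ : 𝒥X.pushforward 𝒥τ qτ ≫ tτ = ∑ h : Subgroup.zpowers τ, 𝒥X.pushforward 𝒥X (act h).hom) (P₀ : AlgPoints X k) :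
    AbelianVariety.IsIsogenous (𝒥X.J ⊞ (𝒥G.J ⊞ 𝒥G.J)) (𝒥σ.J ⊞ (𝒥τ.J ⊞ 𝒥τ.J)) := by
  let ρ : G →* End 𝒥X.J :=
    { toFun := fun g => 𝒥X.pushforward 𝒥X (act g).hom
      map_one' := by
        change 𝒥X.pushforward 𝒥X (act 1).hom = 𝟙 𝒥X.J
        rw [map_one]
        exact 𝒥X.pushforward_id
      map_mul' := fun g g' => by
        change 𝒥X.pushforward 𝒥X (act (g * g')).hom =
          𝒥X.pushforward 𝒥X (act g').hom ≫ 𝒥X.pushforward 𝒥X (act g).hom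
        rw [map_mul, ← pushforward_comp]
        rfl }
  have hN : End.of (∑ g : G, 𝒥X.pushforward 𝒥X (act g).hom) = ∑ g : G, ρ g := rfl
  have hNS : End.of (∑ h : Subgroup.zpowers σ, 𝒥X.pushforward 𝒥X (act h).hom) = ∑ h : Subgroup.zpowers σ, ρ h := rfl
  have hNT : End.of (∑ h : Subgroup.zpowers τ, 𝒥X.pushforward 𝒥X (act h).hom) = ∑ h : Subgroup.zpowers τ, ρ h := rfl
  have h := AbelianVariety.isIsogenous_dihedral_odd ρ hG hodd hτ hστ hN hNS hNT
  have eG := 𝒥X.isIsogenous_image_sum_pushforward_act 𝒥G (fun g : G => act g) qG hqG P₀ tG htG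
  have eσ := 𝒥X.isIsogenous_image_sum_pushforward_act_symm 𝒥σ (fun h : Subgroup.zpowers σ => act h) qσ hqσ P₀ tσ htσ
  have eτ := 𝒥X.isIsogenous_image_sum_pushforward_act_symm 𝒥τ (fun h : Subgroup.zpowers τ => act h) qτ hqτ P₀ tτ htτ
  exact (((AbelianVariety.IsIsogenous.refl 𝒥X.J).biprod (eG.biprod eG)).trans h).trans (eσ.biprod (eτ.biprod eτ))

/-- **The dihedral genus relation, `n` odd: `g_X + 2 g_{X/D_n} = g_{X/⟨σ⟩} + 2 g_{X/⟨τ⟩}`** read on the dimensions of the Jacobians.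
[cite: Paulhus2008, §3.1.2 (5) (p. 236)] [cite: LangeRodriguez2022, §6.2.2 Lemma 6.2.4] [cite: KaniRosen1989, Thm. B] -/
theorem dim_dihedral_odd_quotientJacobian [Fintype (Subgroup.zpowers σ)] [Fintype (Subgroup.zpowers τ)]
    (hG : Fintype.card G = 2 * orderOf σ) (hodd : Odd (orderOf σ)) (hτ : orderOf τ = 2) (hστ : τ * σ * τ⁻¹ = σ⁻¹)
    {YG Yσ Yτ : SchemeOver k} (𝒥G : Jacobian YG) (𝒥σ : Jacobian Yσ) (𝒥τ : Jacobian Yτ)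
    (qG : X ⟶ YG) (hqG : IsSepQuotient (fun g : G => act g) qG) (tG : 𝒥G.J ⟶ 𝒥X.J)
    (htG : 𝒥X.pushforward 𝒥G qG ≫ tG = ∑ g : G, 𝒥X.pushforward 𝒥X (act g).hom)
    (qσ : X ⟶ Yσ) (hqσ : IsSepQuotient (fun h : Subgroup.zpowers σ => act h) qσ) (tσ : 𝒥σ.J ⟶ 𝒥X.J)
    (htσ : 𝒥X.pushforward 𝒥σ qσ ≫ tσ = ∑ h : Subgroup.zpowers σ, 𝒥X.pushforward 𝒥X (act h).hom)
    (qτ : X ⟶ Yτ) (hqτ : IsSepQuotient (fun h : Subgroup.zpowers τ => act h) qτ) (tτ : 𝒥τ.J ⟶ 𝒥X.J)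
    (htτ : 𝒥X.pushforward 𝒥τ qτ ≫ tτ = ∑ h : Subgroup.zpowers τ, 𝒥X.pushforward 𝒥X (act h).hom) (P₀ : AlgPoints X k) :
    𝒥X.J.dim + 2 * 𝒥G.J.dim = 𝒥σ.J.dim + 2 * 𝒥τ.J.dim := by
  have e := (𝒥X.isIsogenous_dihedral_odd_quotientJacobian act hG hodd hτ hστ 𝒥G 𝒥σ 𝒥τ qG hqG tG htG qσ hqσ tσ htσ
    qτ hqτ tτ htτ P₀).dim_eq
  simp only [AbelianVariety.dim_biprod] at e
  omega

/-- **`J_X × J_{X/D_n}² ∼ J_{X/⟨σ⟩} × J_{X/⟨τ⟩} × J_{X/⟨στ⟩}` for `n = |σ|` even** (`τ ∉ ⟨σ⟩`; the reflections fall into the two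
classes of `τ` and `στ`) — ★ `AbelianVariety.isIsogenous_dihedral_even` transported to the quotient Jacobians.
[cite: KaniRosen1989, Thm. B] [cite: Paulhus2008, §3 (3) (p. 234: the case |σ| = 2) and §3.1.2] [cite: LangeRodriguez2022, §3.5.1 Prop. 3.5.1 and Cor. 3.5.2 (a) (p. 65)] -/
theorem isIsogenous_dihedral_even_quotientJacobian [Fintype (Subgroup.zpowers σ)] [Fintype (Subgroup.zpowers τ)]
    [Fintype (Subgroup.zpowers (σ * τ))] (hG : Fintype.card G = 2 * orderOf σ) (heven : Even (orderOf σ))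
    (hτ : orderOf τ = 2) (hστ : τ * σ * τ⁻¹ = σ⁻¹) (hτσ : τ ∉ Subgroup.zpowers σ)
    {YG Yσ Yτ Yστ : SchemeOver k} (𝒥G : Jacobian YG) (𝒥σ : Jacobian Yσ) (𝒥τ : Jacobian Yτ) (𝒥στ : Jacobian Yστ)
    (qG : X ⟶ YG) (hqG : IsSepQuotient (fun g : G => act g) qG) (tG : 𝒥G.J ⟶ 𝒥X.J)
    (htG : 𝒥X.pushforward 𝒥G qG ≫ tG = ∑ g : G, 𝒥X.pushforward 𝒥X (act g).hom)
    (qσ : X ⟶ Yσ) (hqσ : IsSepQuotient (fun h : Subgroup.zpowers σ => act h) qσ) (tσ : 𝒥σ.J ⟶ 𝒥X.J)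
    (htσ : 𝒥X.pushforward 𝒥σ qσ ≫ tσ = ∑ h : Subgroup.zpowers σ, 𝒥X.pushforward 𝒥X (act h).hom)
    (qτ : X ⟶ Yτ) (hqτ : IsSepQuotient (fun h : Subgroup.zpowers τ => act h) qτ) (tτ : 𝒥τ.J ⟶ 𝒥X.J)
    (htτ : 𝒥X.pushforward 𝒥τ qτ ≫ tτ = ∑ h : Subgroup.zpowers τ, 𝒥X.pushforward 𝒥X (act h).hom)
    (qστ : X ⟶ Yστ) (hqστ : IsSepQuotient (fun h : Subgroup.zpowers (σ * τ) => act h) qστ) (tστ : 𝒥στ.J ⟶ 𝒥X.J)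
    (htστ : 𝒥X.pushforward 𝒥στ qστ ≫ tστ = ∑ h : Subgroup.zpowers (σ * τ), 𝒥X.pushforward 𝒥X (act h).hom)
    (P₀ : AlgPoints X k) :
    AbelianVariety.IsIsogenous (𝒥X.J ⊞ (𝒥G.J ⊞ 𝒥G.J)) (𝒥σ.J ⊞ (𝒥τ.J ⊞ 𝒥στ.J)) := by
  let ρ : G →* End 𝒥X.J :=
    { toFun := fun g => 𝒥X.pushforward 𝒥X (act g).hom
      map_one' := by
        change 𝒥X.pushforward 𝒥X (act 1).hom = 𝟙 𝒥X.J
        rw [map_one]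
        exact 𝒥X.pushforward_id
      map_mul' := fun g g' => by
        change 𝒥X.pushforward 𝒥X (act (g * g')).hom =
          𝒥X.pushforward 𝒥X (act g').hom ≫ 𝒥X.pushforward 𝒥X (act g).hom
        rw [map_mul, ← pushforward_comp]
        rfl }
  have hN : End.of (∑ g : G, 𝒥X.pushforward 𝒥X (act g).hom) = ∑ g : G, ρ g := rfl
  have hNS : End.of (∑ h : Subgroup.zpowers σ, 𝒥X.pushforward 𝒥X (act h).hom) = ∑ h : Subgroup.zpowers σ, ρ h := rfl
  have hNT : End.of (∑ h : Subgroup.zpowers τ, 𝒥X.pushforward 𝒥X (act h).hom) = ∑ h : Subgroup.zpowers τ, ρ h := rfl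
  have hNST : End.of (∑ h : Subgroup.zpowers (σ * τ), 𝒥X.pushforward 𝒥X (act h).hom) =
      ∑ h : Subgroup.zpowers (σ * τ), ρ h := rfl
  have h := AbelianVariety.isIsogenous_dihedral_even ρ hG heven hτ hστ hτσ hN hNS hNT hNST
  have eG := 𝒥X.isIsogenous_image_sum_pushforward_act 𝒥G (fun g : G => act g) qG hqG P₀ tG htG
  have eσ := 𝒥X.isIsogenous_image_sum_pushforward_act_symm 𝒥σ (fun h : Subgroup.zpowers σ => act h) qσ hqσ P₀ tσ htσ
  have eτ := 𝒥X.isIsogenous_image_sum_pushforward_act_symm 𝒥τ (fun h : Subgroup.zpowers τ => act h) qτ hqτ P₀ tτ htτ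
  have eστ := 𝒥X.isIsogenous_image_sum_pushforward_act_symm 𝒥στ (fun h : Subgroup.zpowers (σ * τ) => act h) qστ hqστ
    P₀ tστ htστ
  exact (((AbelianVariety.IsIsogenous.refl 𝒥X.J).biprod (eG.biprod eG)).trans h).trans (eσ.biprod (eτ.biprod eστ))

/-- **The dihedral genus relation, `n` even: `g_X + 2 g_{X/D_n} = g_{X/⟨σ⟩} + g_{X/⟨τ⟩} + g_{X/⟨στ⟩}`** on the dimensions of the
Jacobians. [cite: KaniRosen1989, Thm. B] [cite: LangeRodriguez2022, §6.2.2 Lemma 6.2.4] [cite: Paulhus2008, §3 (3) (p. 234)] -/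
theorem dim_dihedral_even_quotientJacobian [Fintype (Subgroup.zpowers σ)] [Fintype (Subgroup.zpowers τ)]
    [Fintype (Subgroup.zpowers (σ * τ))] (hG : Fintype.card G = 2 * orderOf σ) (heven : Even (orderOf σ))
    (hτ : orderOf τ = 2) (hστ : τ * σ * τ⁻¹ = σ⁻¹) (hτσ : τ ∉ Subgroup.zpowers σ)
    {YG Yσ Yτ Yστ : SchemeOver k} (𝒥G : Jacobian YG) (𝒥σ : Jacobian Yσ) (𝒥τ : Jacobian Yτ) (𝒥στ : Jacobian Yστ)
    (qG : X ⟶ YG) (hqG : IsSepQuotient (fun g : G => act g) qG) (tG : 𝒥G.J ⟶ 𝒥X.J)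
    (htG : 𝒥X.pushforward 𝒥G qG ≫ tG = ∑ g : G, 𝒥X.pushforward 𝒥X (act g).hom)
    (qσ : X ⟶ Yσ) (hqσ : IsSepQuotient (fun h : Subgroup.zpowers σ => act h) qσ) (tσ : 𝒥σ.J ⟶ 𝒥X.J)
    (htσ : 𝒥X.pushforward 𝒥σ qσ ≫ tσ = ∑ h : Subgroup.zpowers σ, 𝒥X.pushforward 𝒥X (act h).hom)
    (qτ : X ⟶ Yτ) (hqτ : IsSepQuotient (fun h : Subgroup.zpowers τ => act h) qτ) (tτ : 𝒥τ.J ⟶ 𝒥X.J)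
    (htτ : 𝒥X.pushforward 𝒥τ qτ ≫ tτ = ∑ h : Subgroup.zpowers τ, 𝒥X.pushforward 𝒥X (act h).hom)
    (qστ : X ⟶ Yστ) (hqστ : IsSepQuotient (fun h : Subgroup.zpowers (σ * τ) => act h) qστ) (tστ : 𝒥στ.J ⟶ 𝒥X.J)
    (htστ : 𝒥X.pushforward 𝒥στ qστ ≫ tστ = ∑ h : Subgroup.zpowers (σ * τ), 𝒥X.pushforward 𝒥X (act h).hom)
    (P₀ : AlgPoints X k) :
    𝒥X.J.dim + 2 * 𝒥G.J.dim = 𝒥σ.J.dim + 𝒥τ.J.dim + 𝒥στ.J.dim := by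
  have e := (𝒥X.isIsogenous_dihedral_even_quotientJacobian act hG heven hτ hστ hτσ 𝒥G 𝒥σ 𝒥τ 𝒥στ qG hqG tG htG qσ hqσ
    tσ htσ qτ hqτ tτ htτ qστ hqστ tστ htστ P₀).dim_eq
  simp only [AbelianVariety.dim_biprod] at e
  omega

/-! ## §2 The Klein four-group `V₄ = {1, a, b, ab}` (the case `n = 2`) -/

omit [Fintype G] in
/-- In a Klein four-group an element `≠ 1` has order `2`. [cite: Paulhus2008, §3 (2) (p. 234)] -/
private theorem orderOf_eq_two_of_isKleinFour [IsKleinFour G] {x : G} (hx : x ≠ 1) : orderOf x = 2 :=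
  orderOf_eq_prime (by rw [pow_two, IsKleinFour.mul_self]) hx

omit [Fintype G] in
/-- In a Klein four-group, `b ∉ ⟨a⟩` for `a, b ≠ 1`, `a ≠ b` (`⟨a⟩ = {1, a}`). [cite: Paulhus2008, §3 (2) (p. 234)] -/
private theorem not_mem_zpowers_of_isKleinFour [IsKleinFour G] {a b : G} (ha : a ≠ 1) (hb : b ≠ 1) (hab : a ≠ b) :
    b ∉ Subgroup.zpowers a := by
  intro hmem
  obtain ⟨m, hm⟩ := Subgroup.mem_zpowers_iff.1 hmem
  have h2 : orderOf a = 2 := orderOf_eq_two_of_isKleinFour ha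
  have hmod := zpow_mod_orderOf a m
  rw [h2, hm] at hmod
  rcases Int.emod_two_eq_zero_or_one m with h0 | h1
  · rw [show (m % ((2 : ℕ) : ℤ)) = 0 from h0, zpow_zero] at hmod
    exact hb hmod.symm
  · rw [show (m % ((2 : ℕ) : ℤ)) = 1 from h1, zpow_one] at hmod
    exact hab hmod

/-- **Klein four-group: `J_X × J_{X/V₄}² ∼ J_{X/⟨a⟩} × J_{X/⟨b⟩} × J_{X/⟨ab⟩}`** («(3) `J_X × J²_{X/⟨a,b⟩} ∼ J_{X/⟨a⟩} × J_{X/⟨b⟩} × J_{X/⟨ab⟩}`»)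
for `G = {1, a, b, ab}` (`IsKleinFour G`, `a, b ≠ 1`, `a ≠ b`) acting on `X`, quotients by `G`, `⟨a⟩`, `⟨b⟩`, `⟨ab⟩` with Jacobians and
pinned pull-backs, a rational point on `X`, perfect ground field — the case `n = 2` of `isIsogenous_dihedral_even_quotientJacobian`
(`V₄ = D_2`: `|G| = 2|a|`, `|b| = 2`, `bab⁻¹ = a⁻¹`, `b ∉ ⟨a⟩`). [cite: Paulhus2008, §3 (3) (p. 234)] [cite: KaniRosen1989, Thm. B] -/
theorem isIsogenous_kleinFour_quotientJacobian [IsKleinFour G] {a b : G} [Fintype (Subgroup.zpowers a)]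
    [Fintype (Subgroup.zpowers b)] [Fintype (Subgroup.zpowers (a * b))] (ha : a ≠ 1) (hb : b ≠ 1) (hab : a ≠ b)
    {YG Ya Yb Yab : SchemeOver k} (𝒥G : Jacobian YG) (𝒥a : Jacobian Ya) (𝒥b : Jacobian Yb) (𝒥ab : Jacobian Yab)
    (qG : X ⟶ YG) (hqG : IsSepQuotient (fun g : G => act g) qG) (tG : 𝒥G.J ⟶ 𝒥X.J)
    (htG : 𝒥X.pushforward 𝒥G qG ≫ tG = ∑ g : G, 𝒥X.pushforward 𝒥X (act g).hom)
    (qa : X ⟶ Ya) (hqa : IsSepQuotient (fun h : Subgroup.zpowers a => act h) qa) (ta : 𝒥a.J ⟶ 𝒥X.J)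
    (hta : 𝒥X.pushforward 𝒥a qa ≫ ta = ∑ h : Subgroup.zpowers a, 𝒥X.pushforward 𝒥X (act h).hom)
    (qb : X ⟶ Yb) (hqb : IsSepQuotient (fun h : Subgroup.zpowers b => act h) qb) (tb : 𝒥b.J ⟶ 𝒥X.J)
    (htb : 𝒥X.pushforward 𝒥b qb ≫ tb = ∑ h : Subgroup.zpowers b, 𝒥X.pushforward 𝒥X (act h).hom)
    (qab : X ⟶ Yab) (hqab : IsSepQuotient (fun h : Subgroup.zpowers (a * b) => act h) qab) (tab : 𝒥ab.J ⟶ 𝒥X.J)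
    (htab : 𝒥X.pushforward 𝒥ab qab ≫ tab = ∑ h : Subgroup.zpowers (a * b), 𝒥X.pushforward 𝒥X (act h).hom)
    (P₀ : AlgPoints X k) :
    AbelianVariety.IsIsogenous (𝒥X.J ⊞ (𝒥G.J ⊞ 𝒥G.J)) (𝒥a.J ⊞ (𝒥b.J ⊞ 𝒥ab.J)) := by
  have h2a : orderOf a = 2 := orderOf_eq_two_of_isKleinFour ha
  have hG : Fintype.card G = 2 * orderOf a := by rw [h2a, IsKleinFour.card_four']
  have heven : Even (orderOf a) := by rw [h2a]; exact even_two
  have hba : b * a * b⁻¹ = a⁻¹ := by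
    rw [IsKleinFour.inv_eq_self, IsKleinFour.inv_eq_self, mul_comm_of_exponent_two IsKleinFour.exponent_two b a, mul_assoc,
      IsKleinFour.mul_self, mul_one]
  exact 𝒥X.isIsogenous_dihedral_even_quotientJacobian act hG heven (orderOf_eq_two_of_isKleinFour hb) hba
    (not_mem_zpowers_of_isKleinFour ha hb hab) 𝒥G 𝒥a 𝒥b 𝒥ab qG hqG tG htG qa hqa ta hta qb hqb tb htb qab hqab tab htab P₀

/-- **Accola's genus relation for the Klein four-group: `g_X + 2 g_{X/V₄} = g_{X/⟨a⟩} + g_{X/⟨b⟩} + g_{X/⟨ab⟩}`** on the dimensions of the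
Jacobians. [cite: Paulhus2008, §3 (3) and "equal total dimensions" (p. 234)] [cite: KaniRosen1989, Thm. B] -/
theorem dim_kleinFour_quotientJacobian [IsKleinFour G] {a b : G} [Fintype (Subgroup.zpowers a)]
    [Fintype (Subgroup.zpowers b)] [Fintype (Subgroup.zpowers (a * b))] (ha : a ≠ 1) (hb : b ≠ 1) (hab : a ≠ b)
    {YG Ya Yb Yab : SchemeOver k} (𝒥G : Jacobian YG) (𝒥a : Jacobian Ya) (𝒥b : Jacobian Yb) (𝒥ab : Jacobian Yab)
    (qG : X ⟶ YG) (hqG : IsSepQuotient (fun g : G => act g) qG) (tG : 𝒥G.J ⟶ 𝒥X.J)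
    (htG : 𝒥X.pushforward 𝒥G qG ≫ tG = ∑ g : G, 𝒥X.pushforward 𝒥X (act g).hom)
    (qa : X ⟶ Ya) (hqa : IsSepQuotient (fun h : Subgroup.zpowers a => act h) qa) (ta : 𝒥a.J ⟶ 𝒥X.J)
    (hta : 𝒥X.pushforward 𝒥a qa ≫ ta = ∑ h : Subgroup.zpowers a, 𝒥X.pushforward 𝒥X (act h).hom)
    (qb : X ⟶ Yb) (hqb : IsSepQuotient (fun h : Subgroup.zpowers b => act h) qb) (tb : 𝒥b.J ⟶ 𝒥X.J)
    (htb : 𝒥X.pushforward 𝒥b qb ≫ tb = ∑ h : Subgroup.zpowers b, 𝒥X.pushforward 𝒥X (act h).hom)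
    (qab : X ⟶ Yab) (hqab : IsSepQuotient (fun h : Subgroup.zpowers (a * b) => act h) qab) (tab : 𝒥ab.J ⟶ 𝒥X.J)
    (htab : 𝒥X.pushforward 𝒥ab qab ≫ tab = ∑ h : Subgroup.zpowers (a * b), 𝒥X.pushforward 𝒥X (act h).hom)
    (P₀ : AlgPoints X k) :
    𝒥X.J.dim + 2 * 𝒥G.J.dim = 𝒥a.J.dim + 𝒥b.J.dim + 𝒥ab.J.dim := by
  have e := (𝒥X.isIsogenous_kleinFour_quotientJacobian act ha hb hab 𝒥G 𝒥a 𝒥b 𝒥ab qG hqG tG htG qa hqa ta hta qb hqb tb htb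
    qab hqab tab htab P₀).dim_eq
  simp only [AbelianVariety.dim_biprod] at e
  omega

end Jacobian

end Literature.AlgebraicGeometry.Motives

end
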